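import Mathlib
import Summits.ValiantsHypothesis.ValiantsHypothesis.Theorems.NewtonUnitEquationsDissociatedUniformTotalsLawUnion
import Summits.ValiantsHypothesis.ValiantsHypothesis.Theorems.NewtonUnitEquationsDissociatedUniformTotalsLawUnionVertLowerGrid
import HarnessLib

/-!
# Crux `NewtonUnitEquations.DissociatedUniform` (stmt-ValiantsHypothesis-5905): the pointwise union vertex bound is FALSE —
# part 2/3, the label group, the curves and the cluster structure of the counterexample family

Part 1 (`…TotalsLawUnionVertLowerGrid`) has the planar inequalities; this part defines the family and proves its
combinatorics; part 3 (`…TotalsLawUnionVertLower`) assembles `∀ C, ¬ UnionVertBound C`.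

The family (parameter `m ≥ 1`; `k = 2m`, `K = 8m²`):
* label group `Grp m = ℤ/k × ℤ/K` (`|G| = 16m³`); grid coordinates of a label `y = (i, j)`: `col y = i`,
  `row y = j + Q(i)` with the relabelling parabola `Q(n) = n(n + k)` (representatives in `[0,k)`, `[0,K)`);
* `bC m y = gridPt P M (col y) (row y)` — the projective-convexified grid point (`P = 32m³`, `M = 1024m⁴`);
* `aC m x = apt Λ t_x`, the far-parabola point of parameter `t_x = 2uP/(P + ĉ)` where `u = ubar x ≡ -x₁` and
  `ĉ = chat x ≡ -x₂ + u(k - u)` (`Λ = 524288m⁸`);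
* position set `Zset m = {(-i, Q(i)) : i ∈ ℤ/k}` and class `s = 0`, so that `U_0(Z) = {a x + b y : x + y = (i, -Q(i))}`
  (`mem_U_iff`: the points are `a x + b (yOf x i)`, `yOf x i = (i, -Q(i)) - x`).
THE CLUSTER STRUCTURE (the heart of the construction, `col_row_of_lt` / `col_row_of_ge`): for a cluster `x` with `u ≤ m`
and `ĉ < 4m²`, the partner `yOf x i` has grid coordinates `(i + u, 2u(i + u) + ĉ)` when `i + u < k` — the points of the
grid LINE of slope `2u` and offset `ĉ` on the columns `≥ u` — and `(c, 2uc + ĉ + 2k(u - c))` with `c = i + u - k < u`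
otherwise — points strictly ABOVE that line (because `Q(c + w) - Q(c) = 2w(c + w) + w(k - w)` and `K = 2k²` absorbs the
wrap).  So every translate of the position set is carried by its own rich line; after the projective map of part 1 these
`k·K/2` lines have pairwise distinct slopes `2uP/(P + ĉ)`.  Also here: generic score bounds `dot_bC_bounds`, `dot_aC`, and
injectivity of `x ↦ (u, ĉ)`.
Honest label: a refutation tool (of the located pointwise rung only); `UnionTotalsLaw`, `TotalsLawThree` remain OPEN; nothing
here bears on VP ≠ VNP.
[folklore: elementary modular arithmetic of the relabelled grid]
-/

set_option linter.dupNamespace false -- `ValiantsHypothesis.ValiantsHypothesis` (summit = problem) in every name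

namespace Summit.ValiantsHypothesis.ValiantsHypothesis.Theorems.NewtonUnitEquationsDissociatedUniform

namespace TotalsLaw

namespace UVBCex

open scoped BigOperators Pointwise

/-! ### The parameters of the family (`m ≥ 1`; `k = 2m`, `K = 8m²`, `|G| = 16m³`) -/

/-- The projective parameter `P = 32m³ = 4k³`. -/
noncomputable def Pc (m : ℕ) : ℝ := 32 * (m : ℝ) ^ 3

/-- The convexification parameter `M = 1024m⁴ = 64k⁴`. -/
noncomputable def Mc (m : ℕ) : ℝ := 1024 * (m : ℝ) ^ 4

/-- The size `Λ = 524288m⁸ = 64·K·P²` of the far parabola `A`. -/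
noncomputable def Lc (m : ℕ) : ℝ := 524288 * (m : ℝ) ^ 8

/-- The relabelling parabola `Q(n) = n(n + k)`, `k = 2m`. -/
def qf (m n : ℕ) : ℕ := n * (n + 2 * m)

variable (m : ℕ) [NeZero m]

/-- The label group `G = ℤ/k × ℤ/K` (`k = 2m`, `K = 8m²`). -/
abbrev Grp : Type := ZMod (2 * m) × ZMod (8 * m ^ 2)

/-- Grid column of a label: `col (i, j) = i` (representative in `[0, k)`). -/
def col (y : Grp m) : ℕ := y.1.val

/-- Grid row of a label: `row (i, j) = j + Q(i)` (representative in `[0, K)`) — the PARABOLIC relabelling. -/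
def row (y : Grp m) : ℕ := (y.2 + ((qf m (col m y) : ℕ) : ZMod (8 * m ^ 2))).val

/-- **The second curve `b`**: label `y` ↦ the projective-convexified grid point `(col y, row y)`. -/
noncomputable def bC (y : Grp m) : Fin 2 → ℝ := gridPt (Pc m) (Mc m) (col m y) (row m y)

/-- The slope index `u = -x₁` (representative in `[0, k)`) of the cluster of `x`. -/
def ubar (x : Grp m) : ℕ := (-x.1).val

/-- The line offset `ĉ ≡ -x₂ + u(k - u)` (representative in `[0, K)`) of the cluster of `x`. -/
def chat (x : Grp m) : ℕ := (-x.2 + (((ubar m x : ℤ) * (2 * (m : ℤ) - (ubar m x : ℤ)) : ℤ) : ZMod (8 * m ^ 2))).val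

/-- **The first curve `a`**: label `x` ↦ the far-parabola point of parameter `t_x = 2uP/(P + ĉ)`. -/
noncomputable def aC (x : Grp m) : Fin 2 → ℝ := apt (Lc m) (tpar (Pc m) (ubar m x) (chat m x))

/-- **The position set**: the anti-parabola `{(-i, Q(i)) : i ∈ ℤ/k}` (so that class `0` collects the pairs `x + y = (i, -Q(i))`). -/
def Zset : Set (Grp m) := Set.range fun i : ZMod (2 * m) => ((-i : ZMod (2 * m)), ((qf m i.val : ℕ) : ZMod (8 * m ^ 2)))

/-- The partner of `x` in its cluster indexed by `i`: `y = (i, -Q(i)) - x`. -/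
def yOf (x : Grp m) (i : ZMod (2 * m)) : Grp m := (i - x.1, -((qf m i.val : ℕ) : ZMod (8 * m ^ 2)) - x.2)

/-! ### Class `0` of the family is the union of the clusters `{a x + b (yOf x i)}` -/

omit [NeZero m] in
/-- Membership in class `0`: `p ∈ U_0(Z) ↔ p = a x + b (yOf x i)` for some `x`, `i`. -/
theorem mem_U_iff (p : Fin 2 → ℝ) :
    p ∈ unionPts (aC m) (bC m) (Zset m) 0 ↔ ∃ x i, p = aC m x + bC m (yOf m x i) := by
  rw [mem_unionPts]
  constructor
  · rintro ⟨x, y, ⟨i, hi⟩, rfl⟩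
    refine ⟨x, i, ?_⟩
    have hy : y = yOf m x i := by
      have h1 := congrArg Prod.fst hi
      have h2 := congrArg Prod.snd hi
      simp only [Prod.fst_sub, Prod.fst_zero, Prod.snd_sub, Prod.snd_zero] at h1 h2
      refine Prod.ext ?_ ?_
      · simp only [yOf]; linear_combination h1
      · simp only [yOf]; linear_combination h2
    rw [hy]
  · rintro ⟨x, i, rfl⟩
    refine ⟨x, yOf m x i, ⟨i, ?_⟩, rfl⟩
    refine Prod.ext ?_ ?_
    · simp only [yOf, Prod.fst_sub, Prod.fst_zero]; ring
    · simp only [yOf, Prod.snd_sub, Prod.snd_zero]; ring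

omit [NeZero m] in
/-- Every `a x + b (yOf x i)` lies in class `0`. -/
theorem mem_U (x : Grp m) (i : ZMod (2 * m)) : aC m x + bC m (yOf m x i) ∈ unionPts (aC m) (bC m) (Zset m) 0 :=
  (mem_U_iff m _).2 ⟨x, i, rfl⟩

/-! ### The grid coordinates of a cluster: a LINE on the columns `≥ u`, points `2k(u - c)` rows above it on the columns `< u` -/

omit [NeZero m] in
/-- The relabelling parabola along a translate: `Q(a + w) = Q(a) + 2w(a + w) + w(k - w)` (over `ℤ`). -/
theorem qf_add (a w : ℕ) :
    ((qf m (a + w) : ℕ) : ℤ) = (qf m a : ℕ) + 2 * (w : ℤ) * ((a : ℤ) + w) + (w : ℤ) * (2 * (m : ℤ) - w) := by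
  simp only [qf]; push_cast; ring

/-- The offset `ĉ` as a residue: `ĉ ≡ -x₂ + u(k - u)`. -/
theorem chat_cast (x : Grp m) :
    ((chat m x : ℕ) : ZMod (8 * m ^ 2)) = -x.2 + ((ubar m x : ℤ) * (2 * (m : ℤ) - (ubar m x : ℤ)) : ℤ) := by
  simp only [chat, ZMod.natCast_zmod_val]

/-- `ĉ < K`. -/
theorem chat_lt (x : Grp m) : chat m x < 8 * m ^ 2 := ZMod.val_lt _

/-- `u < k`. -/
theorem ubar_lt (x : Grp m) : ubar m x < 2 * m := ZMod.val_lt _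

/-- `col < k`. -/
theorem col_lt (y : Grp m) : col m y < 2 * m := ZMod.val_lt _

/-- `row < K`. -/
theorem row_lt (y : Grp m) : row m y < 8 * m ^ 2 := ZMod.val_lt _

/-- A residue of `ℤ/K` that is the cast of an integer in `[0, K)` has that integer as its representative. -/
theorem val_eq_of_eq_intCast {z : ZMod (8 * m ^ 2)} {R : ℤ} (h : z = (R : ZMod (8 * m ^ 2))) (h0 : 0 ≤ R)
    (hK : R < 8 * (m : ℤ) ^ 2) : ((z.val : ℕ) : ℤ) = R := by
  rw [h, ZMod.val_intCast]
  have : ((8 * m ^ 2 : ℕ) : ℤ) = 8 * (m : ℤ) ^ 2 := by push_cast; ring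
  rw [this]
  exact Int.emod_eq_of_lt h0 hK

/-- **Cluster, no wrap.**  If `i + u < k` (representatives), the partner `yOf x i` sits at column `i + u` and row
`2u(i + u) + ĉ` — on the LINE of slope `2u` and offset `ĉ` — provided `u ≤ m` and `ĉ < k² = 4m²`. -/
theorem col_row_of_lt (x : Grp m) (i : ZMod (2 * m)) (hu : ubar m x ≤ m) (hc : chat m x < 4 * m ^ 2)
    (hlt : i.val + ubar m x < 2 * m) :
    col m (yOf m x i) = i.val + ubar m x ∧
      ((row m (yOf m x i) : ℕ) : ℤ) = 2 * (ubar m x : ℤ) * ((i.val : ℤ) + ubar m x) + chat m x := by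
  have hcol : col m (yOf m x i) = i.val + ubar m x := by
    simp only [col, yOf, sub_eq_add_neg, ZMod.val_add, ubar]
    exact Nat.mod_eq_of_lt hlt
  refine ⟨hcol, ?_⟩
  have hm : (1 : ℤ) ≤ m := by exact_mod_cast Nat.one_le_iff_ne_zero.2 (NeZero.ne m)
  apply val_eq_of_eq_intCast m
  · rw [hcol]
    simp only [yOf]
    have h1 : ((qf m (i.val + ubar m x) : ℕ) : ZMod (8 * m ^ 2)) =
        (((qf m (i.val + ubar m x) : ℕ) : ℤ) : ZMod (8 * m ^ 2)) := (Int.cast_natCast _).symm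
    have h2 : ((qf m i.val : ℕ) : ZMod (8 * m ^ 2)) = (((qf m i.val : ℕ) : ℤ) : ZMod (8 * m ^ 2)) :=
      (Int.cast_natCast _).symm
    have h3 : -x.2 = ((chat m x : ℕ) : ZMod (8 * m ^ 2)) -
        ((ubar m x : ℤ) * (2 * (m : ℤ) - (ubar m x : ℤ)) : ℤ) := by rw [chat_cast]; ring
    rw [h1, qf_add, sub_eq_add_neg, h3, h2]
    push_cast
    ring
  · have := chat_lt m x; positivity
  · have hi : (i.val : ℤ) + ubar m x ≤ 2 * m - 1 := by
      have : i.val + ubar m x + 1 ≤ 2 * m := hlt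
      linarith [show ((i.val + ubar m x + 1 : ℕ) : ℤ) ≤ ((2 * m : ℕ) : ℤ) from by exact_mod_cast this]
    have hu' : (ubar m x : ℤ) ≤ m := by exact_mod_cast hu
    have hc' : (chat m x : ℤ) ≤ 4 * m ^ 2 - 1 := by
      have : chat m x + 1 ≤ 4 * m ^ 2 := hc
      have := (show ((chat m x + 1 : ℕ) : ℤ) ≤ ((4 * m ^ 2 : ℕ) : ℤ) from by exact_mod_cast this)
      push_cast at this; linarith
    have h0 : (0 : ℤ) ≤ ubar m x := by positivity
    nlinarith

/-- **Cluster, wrap.**  If `i + u = c + k` (representatives), the partner `yOf x i` sits at column `c < u` and row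
`2uc + ĉ + 2k(u - c)` — strictly ABOVE the line — provided `u ≤ m` and `ĉ < 4m²`. -/
theorem col_row_of_ge (x : Grp m) (i : ZMod (2 * m)) (hu : ubar m x ≤ m) (hc : chat m x < 4 * m ^ 2) (c : ℕ)
    (hcw : i.val + ubar m x = c + 2 * m) :
    col m (yOf m x i) = c ∧ c < ubar m x ∧
      ((row m (yOf m x i) : ℕ) : ℤ) = 2 * (ubar m x : ℤ) * c + chat m x + 4 * (m : ℤ) * ((ubar m x : ℤ) - c) := by
  have hi : i.val < 2 * m := ZMod.val_lt i
  have hcu : c < ubar m x := by omega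
  have hcol : col m (yOf m x i) = c := by
    simp only [col, yOf, sub_eq_add_neg, ZMod.val_add, ubar] at hcw ⊢
    rw [hcw, Nat.add_mod_right]
    exact Nat.mod_eq_of_lt (by omega)
  refine ⟨hcol, hcu, ?_⟩
  have hm : (1 : ℤ) ≤ m := by exact_mod_cast Nat.one_le_iff_ne_zero.2 (NeZero.ne m)
  -- `i = c + w` with `u + w = k`
  obtain ⟨w, hw⟩ : ∃ w : ℕ, ubar m x + w = 2 * m := ⟨2 * m - ubar m x, by have := ubar_lt m x; omega⟩
  have hiw : i.val = c + w := by omega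
  apply val_eq_of_eq_intCast m
  · rw [hcol]
    simp only [yOf]
    have h1 : ((qf m c : ℕ) : ZMod (8 * m ^ 2)) = (((qf m c : ℕ) : ℤ) : ZMod (8 * m ^ 2)) := (Int.cast_natCast _).symm
    have h2 : ((qf m i.val : ℕ) : ZMod (8 * m ^ 2)) = (((qf m (c + w) : ℕ) : ℤ) : ZMod (8 * m ^ 2)) := by
      rw [hiw]; exact (Int.cast_natCast _).symm
    have h3 : -x.2 = ((chat m x : ℕ) : ZMod (8 * m ^ 2)) -
        ((ubar m x : ℤ) * (2 * (m : ℤ) - (ubar m x : ℤ)) : ℤ) := by rw [chat_cast]; ring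
    have hK : ((8 * m ^ 2 : ℕ) : ZMod (8 * m ^ 2)) = 0 := ZMod.natCast_self _
    have hw' : ((ubar m x : ℤ) : ZMod (8 * m ^ 2)) + (w : ℤ) = 2 * (m : ℤ) := by
      have : ((ubar m x + w : ℕ) : ℤ) = ((2 * m : ℕ) : ℤ) := by rw [hw]
      push_cast at this ⊢
      exact_mod_cast congrArg (fun z : ℤ => (z : ZMod (8 * m ^ 2))) this
    rw [h2, qf_add, sub_eq_add_neg _ x.2, h3, h1]
    push_cast at hK hw' ⊢
    linear_combination (-(w : ZMod (8 * m ^ 2)) - 4 * (m : ZMod (8 * m ^ 2)) + ((ubar m x : ℕ) : ZMod (8 * m ^ 2)) -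
      2 * (c : ZMod (8 * m ^ 2))) * hw' - hK
  · have h0 : (0 : ℤ) ≤ ubar m x := by positivity
    have : (c : ℤ) + 1 ≤ ubar m x := by exact_mod_cast hcu
    have := chat_lt m x
    nlinarith
  · have hu' : (ubar m x : ℤ) ≤ m := by exact_mod_cast hu
    have hc' : (chat m x : ℤ) ≤ 4 * m ^ 2 - 1 := by
      have : chat m x + 1 ≤ 4 * m ^ 2 := hc
      have := (show ((chat m x + 1 : ℕ) : ℤ) ≤ ((4 * m ^ 2 : ℕ) : ℤ) from by exact_mod_cast this)
      push_cast at this; linarith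
    have h0 : (0 : ℤ) ≤ c := by positivity
    have : (c : ℤ) + 1 ≤ ubar m x := by exact_mod_cast hcu
    nlinarith

omit [NeZero m] in
/-- Every `i` falls under exactly one of the two cases (`i + u < k` or `i + u = c + k` with `c = i + u - k`). -/
theorem lt_or_wrap (x : Grp m) (i : ZMod (2 * m)) :
    i.val + ubar m x < 2 * m ∨ ∃ c : ℕ, i.val + ubar m x = c + 2 * m := by
  by_cases h : i.val + ubar m x < 2 * m
  · exact Or.inl h
  · exact Or.inr ⟨i.val + ubar m x - 2 * m, by omega⟩

/-! ### The score of `b y` for a weight `(σ, -1)`: generic bounds -/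

/-- `P > 0`. -/
theorem Pc_pos : 0 < Pc m := by
  have : (0 : ℝ) < m := by exact_mod_cast Nat.pos_of_ne_zero (NeZero.ne m)
  unfold Pc; positivity

/-- `M > 0`. -/
theorem Mc_pos : 0 < Mc m := by
  have : (0 : ℝ) < m := by exact_mod_cast Nat.pos_of_ne_zero (NeZero.ne m)
  unfold Mc; positivity

omit [NeZero m] in
/-- The score of `b y` is `gval` at its grid coordinates. -/
theorem dot_bC (σ : ℝ) (y : Grp m) : ![σ, -1] ⬝ᵥ bC m y = gval (Pc m) (Mc m) σ (col m y) (row m y) :=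
  dot_gridPt _ _ _ _ _

/-- **Generic bounds**: `-(K + 1) ≤ ⟨(σ,-1), b y⟩ ≤ σ·k` for every label `y` and every `σ ≥ 0`. -/
theorem dot_bC_bounds {σ : ℝ} (hσ : 0 ≤ σ) (y : Grp m) :
    -((8 * (m : ℝ) ^ 2) + 1) ≤ ![σ, -1] ⬝ᵥ bC m y ∧ ![σ, -1] ⬝ᵥ bC m y ≤ σ * (2 * m) := by
  have hm : (1 : ℝ) ≤ m := by exact_mod_cast Nat.one_le_iff_ne_zero.2 (NeZero.ne m)
  have hcol : (col m y : ℝ) ≤ 2 * m := by exact_mod_cast (col_lt m y).le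
  have hrow : (row m y : ℝ) ≤ 8 * (m : ℝ) ^ 2 := by exact_mod_cast (row_lt m y).le
  rw [dot_bC]
  refine ⟨neg_le_gval (Pc_pos m) (Mc_pos m) hσ (Nat.cast_nonneg _) hcol (Nat.cast_nonneg _) hrow ?_,
    gval_le (Pc_pos m) (Mc_pos m) hσ (Nat.cast_nonneg _) hcol (Nat.cast_nonneg _)⟩
  have h4 : (m : ℝ) ^ 2 ≤ (m : ℝ) ^ 4 := pow_le_pow_right₀ hm (by norm_num)
  unfold Mc; nlinarith

omit [NeZero m] in
/-- The score of `a x` is `Λ(σ t_x − t_x²/2)`. -/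
theorem dot_aC (σ : ℝ) (x : Grp m) :
    ![σ, -1] ⬝ᵥ aC m x = Lc m * (σ * tpar (Pc m) (ubar m x) (chat m x) - tpar (Pc m) (ubar m x) (chat m x) ^ 2 / 2) :=
  dot_apt _ _ _

/-- `x` is determined by `(u, ĉ)`. -/
theorem eq_of_ubar_eq_of_chat_eq {x x' : Grp m} (hu : ubar m x = ubar m x') (hc : chat m x = chat m x') : x = x' := by
  have h1 : x.1 = x'.1 := by
    have := ZMod.val_injective _ hu
    exact neg_injective this
  have h2 : x.2 = x'.2 := by
    have h := ZMod.val_injective _ hc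
    rw [hu] at h
    have := add_right_cancel h
    exact neg_injective this
  exact Prod.ext h1 h2

end UVBCex

end TotalsLaw

end Summit.ValiantsHypothesis.ValiantsHypothesis.Theorems.NewtonUnitEquationsDissociatedUniform
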